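import Summits.QuantumFields.YangMills.Theorems.ChatterjeeMassGapTorusAxialBoxBitCompact
import HarnessLib

/-!
# Crux `NT` (stmt-QuantumFields-19353), strong-coupling rung 3: convolution powers of the centred character up to the
# eighteenth — `φ^{⋆18}(1) = ‖φ^{⋆9}‖² > 0`

Helper file of the fleet lead prover of crux `NT` (unit `ym-spine-19353-p1`, g26), for the stub `stub_higherMirror_free_jet`
of `Cruxes/NT/Lines/slab_response_fh_rung3.lean`: the Haar constant of the eighteen-face tubes is the eighteenth convolution
power of `φ = Re tr ρ − m₀` at the identity (`…LongTubeIntegral`); here the group-theory-free positivity, exactly as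
`S28BoxConv.conv_power_nine_at_one_pos` for the ten-face box:

* `single_three` — the fourth unit vector of `ℤ⁴` as a literal vector (the first three are `S28DistanceTwoPositivity.single_*`);
* `conv_power_data` — the convolution powers `P k = φ^{⋆(k+1)}` of `φ = Re tr ρ − m₀` (continuous `ρ`, `Re tr ρ(h⁻¹) = Re tr ρ(h)`)
  are continuous inversion-invariant class functions with the two kernel identities of the MERGE;
* `conv_power_seventeen_at_one_pos` — `φ ≢ 0 ⇒ P 17 (1) = ‖P 8‖² > 0`.

HONEST FRAMING: Haar-measure algebra on an arbitrary compact group; nothing about `β`, NT or the gap. [folklore]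
-/

noncomputable section

open MeasureTheory Filter Topology
open Literature.MathematicalPhysics.QuantumLattice
open Literature.MathematicalPhysics.QuantumFieldTheory (zdHaar haarProbability)
open Literature.Probability.LatticeModels (Site)

namespace Summit.QuantumFields.YangMills.Cruxes.NT.StrongCouplingRung.LongTube

open Summit.QuantumFields.YangMills.Theorems.S28BoxConv Summit.QuantumFields.YangMills.Theorems

variable {N : ℕ} {G : Type} [Group G] [TopologicalSpace G] [IsTopologicalGroup G]
  [CompactSpace G] [MeasurableSpace G] [BorelSpace G] [SecondCountableTopology G]
  (ρ : G →* Matrix (Fin N) (Fin N) ℂ)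

/-- The fourth unit lattice vector of `ℤ⁴` as a literal vector (the first three: `S28DistanceTwoPositivity.single_zero/one/two`).
(kernel computation) -/
theorem single_three : (Pi.single 3 1 : Site 4) = ![0, 0, 0, 1] := by decide +kernel

omit [SecondCountableTopology G] in
/-- **Convolution powers of the centred character.**  For continuous `ρ` with `Re tr ρ(h⁻¹) = Re tr ρ(h)` and
`P 0 = φ = Re tr ρ − m₀`, `P (k+1) = P k ⋆ φ`: every `P k` is a continuous class function, `φ` is inversion-invariant, and
the kernel identities `∫ P k(x g⁻¹) φ(g y) dg = P (k+1)(x y) = ∫ φ(x g⁻¹) P k(g y) dg` hold. [folklore] -/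
theorem conv_power_data (hρ : Continuous ρ) (hinvρ : ∀ h : G, ((ρ h⁻¹).trace).re = ((ρ h).trace).re)
    {P : ℕ → G → ℝ} (hP0 : P 0 = fun g => (ρ g).trace.re - ∫ g, (ρ g).trace.re ∂haarProbability G)
    (hstep : ∀ k : ℕ, P (k + 1) = haarConv (P k) (P 0)) :
    (∀ k, Continuous (P k)) ∧ (∀ (k : ℕ) (s t : G), P k (s * t) = P k (t * s)) ∧ (∀ h : G, P 0 h⁻¹ = P 0 h) ∧
      (∀ (k : ℕ) (x y : G), ∫ g, P k (x * g⁻¹) * P 0 (g * y) ∂haarProbability G = P (k + 1) (x * y)) ∧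
      (∀ (k : ℕ) (x y : G), ∫ g, P 0 (x * g⁻¹) * P k (g * y) ∂haarProbability G = P (k + 1) (x * y)) := by
  have hφ : Continuous (P 0) := by
    rw [hP0]; exact (Complex.continuous_re.comp hρ.matrix_trace).sub continuous_const
  have hcl : ∀ s t : G, P 0 (s * t) = P 0 (t * s) := fun s t => by
    rw [hP0]; simp only [S28BoxBitSUN.re_trace_map_mul_comm ρ s t]
  have hinv : ∀ h : G, P 0 h⁻¹ = P 0 h := fun h => by rw [hP0]; simp only [hinvρ h]
  have hPc := conv_power_continuous hφ rfl hstep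
  have hPcl := conv_power_class hcl rfl hstep
  refine ⟨hPc, hPcl, hinv, fun k x y => ?_, fun k x y => ?_⟩
  · rw [kernel_right, hstep k]
  · rw [kernel_left _ _ (hPcl k), hstep k]

omit [SecondCountableTopology G] in
/-- `φ ≢ 0 ⇒ φ^{⋆18}(1) = ‖φ^{⋆9}‖² > 0`: `P (2a+1)(1) = ‖P a‖²` (`conv_power_double_pos`) climbs `0 → 1 → 3 → 7 → 15`, and
non-vanishing descends `15 → 8` (`conv_power_ne_of_succ`). [folklore] -/
theorem conv_power_seventeen_at_one_pos [T2Space G] {φ : G → ℝ} {P : ℕ → G → ℝ} (hφ : Continuous φ)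
    (hcl : ∀ s t : G, φ (s * t) = φ (t * s)) (hinv : ∀ h : G, φ h⁻¹ = φ h) (hP0 : P 0 = φ)
    (hstep : ∀ k : ℕ, P (k + 1) = haarConv (P k) φ) (h0 : ∃ g, φ g ≠ 0) : 0 < P 17 1 := by
  have ne_of_pos : ∀ {k : ℕ}, 0 < P k 1 → ∃ g, P k g ≠ 0 := fun h => ⟨1, h.ne'⟩
  have h0' : ∃ g, P 0 g ≠ 0 := by rw [hP0]; exact h0
  have h1 : 0 < P 1 1 := conv_power_double_pos hφ hcl hinv hP0 hstep (a := 0) h0'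
  have h3 : 0 < P 3 1 := conv_power_double_pos hφ hcl hinv hP0 hstep (a := 1) (ne_of_pos h1)
  have h7 : 0 < P 7 1 := conv_power_double_pos hφ hcl hinv hP0 hstep (a := 3) (ne_of_pos h3)
  have h15 : 0 < P 15 1 := conv_power_double_pos hφ hcl hinv hP0 hstep (a := 7) (ne_of_pos h7)
  have h14 := conv_power_ne_of_succ hstep (k := 14) (ne_of_pos h15)
  have h13 := conv_power_ne_of_succ hstep (k := 13) h14
  have h12 := conv_power_ne_of_succ hstep (k := 12) h13
  have h11 := conv_power_ne_of_succ hstep (k := 11) h12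
  have h10 := conv_power_ne_of_succ hstep (k := 10) h11
  have h9 := conv_power_ne_of_succ hstep (k := 9) h10
  have h8 := conv_power_ne_of_succ hstep (k := 8) h9
  exact conv_power_double_pos hφ hcl hinv hP0 hstep (a := 8) h8


end Summit.QuantumFields.YangMills.Cruxes.NT.StrongCouplingRung.LongTube

end
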